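import Summits.FinalStateConjecture.FinalStateConjecture.Theorems.PhotonSphereChannelsChannelsResolveTameDevelopmentsRHorizonGeneratorPaths
import Literature.Geometry.Lorentzian.EventHorizonNonempty
import HarnessLib

/-!
# Horizon generator paths of a development exist iff it contains a black hole
# (crux `ChannelsResolveTameDevelopmentsR` = K2R-T2, item `stmt-FinalStateConjecture-17430`; line
# `dark-future-exactness`, stubs A(b)(c), K, N1, T; route PhotonSphereChannels, seat 0)

Sequel of `…RHorizonGeneratorPaths` (p150947: through every point of
`horizonOf 𝒟 = 𝒟.eventHorizonOf (outerRegion 𝒟)` passes a horizon generator path, the conjuncts of the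
line's `IsHorizonPath` verbatim). The line `dark-future-exactness` quantifies its stubs A(b), K, N1 and T
over horizon generator paths `γ` of the development and treats the alternative "no horizon" separately
(N2, and the `N = 0` case of the endgame T). This file decides WHEN such paths exist, by causal theory
alone:

* `outerRegion_subset_chronologicalPast` — the outer region `J⁺(ι X) ∩ ⋃ I⁻(complete rays)` lies in its
  own chronological past, `outer ⊆ I⁻(outer)` (push-up along the witnessing timelike curve,
  `mem_chronologicalPast_outerRegion`); with `chronologicalPast_outerRegion_inter_causalFuture`:
  `I⁻(outer) ∩ J⁺(ι X) = outer`;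
* `causalFuture_diff_chronologicalPast_outerRegion` — the set `J⁺(ι X) ∖ I⁻(outer)` is the part of the
  intrinsic BLACK-HOLE REGION `𝓑 = M ∖ J⁻(𝓘⁺)` (`DataEmbedding.blackHoleRegion`) to the causal future of
  the data;
* `eventHorizonOf_outerRegion_nonempty_iff` — **`horizonOf 𝒟` is nonempty iff the outer region is
  nonempty AND the black-hole region meets `J⁺(ι X)`** (⇒: a frontier point of the open set `I⁻(outer)`
  is outside it and `I⁻(∅) = ∅`; ⇐: `J⁺(ι X)` is preconnected, `CauchyDevelopment.nonempty_eventHorizonOf`);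
  equivalently (`eventHorizonOf_outerRegion_eq_empty_iff`) for a development with nonempty outer region:
  NO horizon iff every event to the causal future of the data is visible from infinity,
  `J⁺(ι X) ⊆ I⁻(outer)`;
* `exists_horizonPath_iff` / `exists_horizonPath_iff_blackHole` — **horizon generator paths (continuous,
  in `horizonOf 𝒟`, in `closure outer`, causally monotone, future-escaping) exist iff `horizonOf 𝒟` is
  nonempty iff the outer region is nonempty and `𝓑 ∩ J⁺(ι X) ≠ ∅`**;
* `stub_horizonPathsExist_iff` — the registered stub of item 17430 (self-contained text).

So, for a development as in the crux with nonempty outer region (the explicit conjunct of the reshaped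
producer stub A′ of lead c7), the based hulls `Ω_γ` of stubs K/N1 are indexed by a nonempty family of
paths exactly in the black-hole case, and are (correctly) vacuous exactly in the dispersive case
`J⁺(ι X) ⊆ J⁻(𝓘⁺)`. No tameness, vacuum or maximality hypothesis is used.

References: S. W. Hawking, G. F. R. Ellis, *The large scale structure of space-time* (CUP 1973), §9.2,
pp. 312, 319; R. M. Wald, *General Relativity* (1984), §12.1; B. O'Neill, *Semi-Riemannian geometry*
(1983), Ch. 14, pp. 402–403.
-/

noncomputable section

-- every `Summit.FinalStateConjecture.FinalStateConjecture.…` name repeats the summit = sub-problem segment (D-0017 layout)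
set_option linter.dupNamespace false

open Set Filter Function TopologicalSpace
open scoped Topology Manifold ContDiff

namespace Summit.FinalStateConjecture.FinalStateConjecture.Theorems.ChannelsResolveTameDevelopmentsR.HorizonGenerators

open Literature.Geometry.Lorentzian
open Summit.FinalStateConjecture.FinalStateConjecture.Theorems.TameHull

variable {X : Type} [TopologicalSpace X] [ChartedSpace E3 X] [IsManifold (𝓡 3) ∞ X]
  [T2Space X] [SecondCountableTopology X] [ConnectedSpace X] {D : InitialDataSet (𝓡 3) X}

section Outer

variable (𝒟 : VacuumCauchyDevelopment D) [𝒟.metric.HasLeviCivita]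

omit [T2Space X] [SecondCountableTopology X] in
/-- **The outer region lies in its own chronological past**, `outer ⊆ I⁻(outer)`: a point `q` of
`J⁺(ι X)` in `I⁻` of a complete ray sees, strictly to its chronological future, another such point
(push-up, `mem_chronologicalPast_outerRegion`). [cite: HawkingEllis1973CUP, §9.2 (p. 312)] -/
theorem outerRegion_subset_chronologicalPast :
    outerRegion 𝒟 ⊆ 𝒟.metric.chronologicalPast 𝒟.timeOrientation (outerRegion 𝒟) :=
  fun _ hq ↦ mem_chronologicalPast_outerRegion 𝒟 hq.1 hq.2

omit [T2Space X] [SecondCountableTopology X] in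
/-- `I⁻(outer) ∩ J⁺(ι X) = outer`: to the causal future of the data, the chronological past of the outer
region is the outer region itself (`I⁻(outer) ⊆ visibleRegion` and `outer = J⁺(ι X) ∩ visibleRegion`).
[cite: HawkingEllis1973CUP, §9.2 (p. 312)] -/
theorem chronologicalPast_outerRegion_inter_causalFuture :
    𝒟.metric.chronologicalPast 𝒟.timeOrientation (outerRegion 𝒟) ∩
        𝒟.metric.causalFuture 𝒟.timeOrientation (range 𝒟.embed) = outerRegion 𝒟 := by
  ext x
  exact ⟨fun hx ↦ ⟨hx.2, chronologicalPast_outerRegion_subset_visibleRegion 𝒟 hx.1⟩,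
    fun hx ↦ ⟨outerRegion_subset_chronologicalPast 𝒟 hx, hx.1⟩⟩

omit [T2Space X] [SecondCountableTopology X] in
/-- **`J⁺(ι X) ∖ I⁻(outer)` is the black-hole region to the causal future of the data**:
`J⁺(ι X) ∖ I⁻(outer) = J⁺(ι X) ∩ 𝓑`, `𝓑 = M ∖ J⁻(𝓘⁺)` the intrinsic black-hole region
(`DataEmbedding.blackHoleRegion`, the complement of the visible region). [cite: Wald1984, §12.1 (12.1.2)] -/
theorem causalFuture_diff_chronologicalPast_outerRegion :
    𝒟.metric.causalFuture 𝒟.timeOrientation (range 𝒟.embed) \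
        𝒟.metric.chronologicalPast 𝒟.timeOrientation (outerRegion 𝒟) =
      𝒟.metric.causalFuture 𝒟.timeOrientation (range 𝒟.embed) ∩ 𝒟.toDataEmbedding.blackHoleRegion := by
  ext x
  rw [DataEmbedding.blackHoleRegion_eq_compl]
  exact ⟨fun hx ↦ ⟨hx.1, fun hV ↦ hx.2 (mem_chronologicalPast_outerRegion 𝒟 hx.1 hV)⟩,
    fun hx ↦ ⟨hx.1, fun hI ↦ hx.2 (chronologicalPast_outerRegion_subset_visibleRegion 𝒟 hI)⟩⟩

omit [T2Space X] [SecondCountableTopology X] in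
/-- **The horizon of the development is nonempty iff its outer region is nonempty and its black-hole
region meets `J⁺(ι X)`.** (⇒) a point of `horizonOf 𝒟 = ∂I⁻(outer) ∩ J⁺(ι X)` lies in the closure of
`I⁻(outer)` (so `outer ≠ ∅`, as `I⁻(∅) = ∅`) and not in the open set `I⁻(outer)` itself; (⇐) the
preconnected set `J⁺(ι X)` meets the open set `I⁻(outer) ⊇ outer` and its complement, hence its frontier
(`CauchyDevelopment.nonempty_eventHorizonOf`). [cite: HawkingEllis1973CUP, §9.2 (p. 312)] -/
theorem eventHorizonOf_outerRegion_nonempty_iff :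
    (𝒟.toCauchyDevelopment.eventHorizonOf (outerRegion 𝒟)).Nonempty ↔
      (outerRegion 𝒟).Nonempty ∧
        (𝒟.metric.causalFuture 𝒟.timeOrientation (range 𝒟.embed) \
          𝒟.metric.chronologicalPast 𝒟.timeOrientation (outerRegion 𝒟)).Nonempty := by
  have hWopen : IsOpen (𝒟.metric.chronologicalPast 𝒟.timeOrientation (outerRegion 𝒟)) :=
    LorentzianMetric.isOpen_chronologicalPast_of_boundaryless _ _ _
  constructor
  · rintro ⟨h, hfr, hJ⟩
    refine ⟨?_, h, hJ, fun hW ↦ ?_⟩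
    · -- `h ∈ closure I⁻(outer)`, so `I⁻(outer) ≠ ∅`, so `outer ≠ ∅`
      obtain ⟨x, p, hp, -⟩ := closure_nonempty_iff.1 ⟨h, frontier_subset_closure hfr⟩
      exact ⟨p, hp⟩
    · rw [hWopen.frontier_eq] at hfr
      exact hfr.2 hW
  · rintro ⟨hne, hB⟩
    exact 𝒟.toCauchyDevelopment.nonempty_eventHorizonOf
      (hne.mono fun q hq ↦ ⟨hq.1, outerRegion_subset_chronologicalPast 𝒟 hq⟩) hB

omit [T2Space X] [SecondCountableTopology X] in
/-- **No horizon iff no black hole to the future of the data**: for a development with nonempty outer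
region, `horizonOf 𝒟 = ∅` iff every event of `J⁺(ι X)` is visible from infinity, `J⁺(ι X) ⊆ I⁻(outer)`.
[cite: HawkingEllis1973CUP, §9.2 (p. 312)] -/
theorem eventHorizonOf_outerRegion_eq_empty_iff (hne : (outerRegion 𝒟).Nonempty) :
    𝒟.toCauchyDevelopment.eventHorizonOf (outerRegion 𝒟) = ∅ ↔
      𝒟.metric.causalFuture 𝒟.timeOrientation (range 𝒟.embed) ⊆
        𝒟.metric.chronologicalPast 𝒟.timeOrientation (outerRegion 𝒟) := by
  rw [← Set.sdiff_eq_empty, ← not_nonempty_iff_eq_empty, ← not_nonempty_iff_eq_empty,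
    eventHorizonOf_outerRegion_nonempty_iff, not_and]
  exact ⟨fun h ↦ h hne, fun h _ ↦ h⟩

omit [T2Space X] [SecondCountableTopology X] in
/-- **Horizon generator paths exist iff the horizon is nonempty**: a path (continuous, in `horizonOf 𝒟`, in
`closure outer`, causally monotone, future-escaping — the conjuncts of `IsHorizonPath` of line
`dark-future-exactness`) passes through every horizon point (`exists_horizonPath_through`), and any such path
has its value at `0` on the horizon. [cite: HawkingEllis1973CUP, §9.2 (p. 319)] -/
theorem exists_horizonPath_iff :
    (∃ γ : ℝ → 𝒟.carrier, Continuous γ ∧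
        (∀ s, γ s ∈ 𝒟.toCauchyDevelopment.eventHorizonOf (outerRegion 𝒟)) ∧
        (∀ s, γ s ∈ closure (outerRegion 𝒟)) ∧
        (∀ s s' : ℝ, s ≤ s' → γ s' ∈ 𝒟.metric.causalFuture 𝒟.timeOrientation {γ s}) ∧
        ∀ K : Set 𝒟.carrier, IsCompact K →
          ∀ᶠ s in atTop, γ s ∉ 𝒟.metric.causalPast 𝒟.timeOrientation K) ↔
      (𝒟.toCauchyDevelopment.eventHorizonOf (outerRegion 𝒟)).Nonempty := by
  refine ⟨fun ⟨γ, _, hγ, _⟩ ↦ ⟨γ 0, hγ 0⟩, fun ⟨h, hh⟩ ↦ ?_⟩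
  obtain ⟨γ, -, hc, h₁, h₂, h₃, h₄⟩ := exists_horizonPath_through 𝒟 hh
  exact ⟨γ, hc, h₁, h₂, h₃, h₄⟩

omit [T2Space X] [SecondCountableTopology X] in
/-- **Horizon generator paths exist iff the development contains a black hole**: iff the outer region is
nonempty and the black-hole region meets `J⁺(ι X)` (`exists_horizonPath_iff` +
`eventHorizonOf_outerRegion_nonempty_iff`). [cite: HawkingEllis1973CUP, §9.2 (pp. 312, 319)] -/
theorem exists_horizonPath_iff_blackHole :
    (∃ γ : ℝ → 𝒟.carrier, Continuous γ ∧
        (∀ s, γ s ∈ 𝒟.toCauchyDevelopment.eventHorizonOf (outerRegion 𝒟)) ∧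
        (∀ s, γ s ∈ closure (outerRegion 𝒟)) ∧
        (∀ s s' : ℝ, s ≤ s' → γ s' ∈ 𝒟.metric.causalFuture 𝒟.timeOrientation {γ s}) ∧
        ∀ K : Set 𝒟.carrier, IsCompact K →
          ∀ᶠ s in atTop, γ s ∉ 𝒟.metric.causalPast 𝒟.timeOrientation K) ↔
      (outerRegion 𝒟).Nonempty ∧
        (𝒟.metric.causalFuture 𝒟.timeOrientation (range 𝒟.embed) \
          𝒟.metric.chronologicalPast 𝒟.timeOrientation (outerRegion 𝒟)).Nonempty :=
  (exists_horizonPath_iff 𝒟).trans (eventHorizonOf_outerRegion_nonempty_iff 𝒟)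

omit [T2Space X] [SecondCountableTopology X] in
/-- The same with the black-hole region named: horizon generator paths exist iff the outer region is
nonempty and `J⁺(ι X) ∩ 𝓑 ≠ ∅`. [cite: Wald1984, §12.1 (12.1.2)] -/
theorem exists_horizonPath_iff_blackHoleRegion :
    (∃ γ : ℝ → 𝒟.carrier, Continuous γ ∧
        (∀ s, γ s ∈ 𝒟.toCauchyDevelopment.eventHorizonOf (outerRegion 𝒟)) ∧
        (∀ s, γ s ∈ closure (outerRegion 𝒟)) ∧
        (∀ s s' : ℝ, s ≤ s' → γ s' ∈ 𝒟.metric.causalFuture 𝒟.timeOrientation {γ s}) ∧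
        ∀ K : Set 𝒟.carrier, IsCompact K →
          ∀ᶠ s in atTop, γ s ∉ 𝒟.metric.causalPast 𝒟.timeOrientation K) ↔
      (outerRegion 𝒟).Nonempty ∧
        (𝒟.metric.causalFuture 𝒟.timeOrientation (range 𝒟.embed) ∩
          𝒟.toDataEmbedding.blackHoleRegion).Nonempty := by
  rw [exists_horizonPath_iff_blackHole, causalFuture_diff_chronologicalPast_outerRegion]

end Outer

/-! ### The registered stub (self-contained text) -/

/-- **Registered stub `stub_horizonPathsExist_iff` of stmt-FinalStateConjecture-17430**: for every vacuum
Cauchy development `𝒟` of data on a `3`-manifold, horizon generator paths (continuous `γ : ℝ → 𝒟`, in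
`𝒟.eventHorizonOf (outerRegion 𝒟)`, in `closure (outerRegion 𝒟)`, causally monotone, future-escaping —
the conjuncts of `IsHorizonPath` of line `dark-future-exactness`) exist iff the outer region is nonempty and
some event of `J⁺(ι X)` is not in `I⁻(outerRegion 𝒟)` (the development contains a black hole).
[cite: HawkingEllis1973CUP, §9.2 (pp. 312, 319)] -/
theorem stub_horizonPathsExist_iff : ∀ (X : Type) [TopologicalSpace X] [ChartedSpace E3 X] [IsManifold (𝓡 3) ∞ X] [T2Space X] [SecondCountableTopology X] [ConnectedSpace X] (D : InitialDataSet (𝓡 3) X) (𝒟 : VacuumCauchyDevelopment D) [𝒟.metric.HasLeviCivita], (∃ γ : ℝ → 𝒟.carrier, Continuous γ ∧ (∀ s, γ s ∈ 𝒟.toCauchyDevelopment.eventHorizonOf (outerRegion 𝒟)) ∧ (∀ s, γ s ∈ closure (outerRegion 𝒟)) ∧ (∀ s s' : ℝ, s ≤ s' → γ s' ∈ 𝒟.metric.causalFuture 𝒟.timeOrientation {γ s}) ∧ ∀ K : Set 𝒟.carrier, IsCompact K → ∀ᶠ s in Filter.atTop, γ s ∉ 𝒟.metric.causalPast 𝒟.timeOrientation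 K) ↔ (outerRegion 𝒟).Nonempty ∧ (𝒟.metric.causalFuture 𝒟.timeOrientation (Set.range 𝒟.embed) \ 𝒟.metric.chronologicalPast 𝒟.timeOrientation (outerRegion 𝒟)).Nonempty :=
  fun _ _ _ _ _ _ _ _ 𝒟 _ ↦ exists_horizonPath_iff_blackHole 𝒟

end Summit.FinalStateConjecture.FinalStateConjecture.Theorems.ChannelsResolveTameDevelopmentsR.HorizonGenerators

end
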